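/-
Origin: expansion seat `planner-pub-hodgecm-mc-period-1-g13-0`, handover #P43b 2026-08-20T06:52Z md5 e49c7781e83d (81 l., 3 theorems, all `rfl`; NEW additive bridge leaf; imports HodgeCM.Model.ArchSideOfTwist (#P43a, this kit) + HodgeCM.Model.ArchSideOfChar (carch-1 #CA22 182e52b712e4, kit t43-mccarch1g3.txt); RUN 43; rowdeps {#P43a, #CA22} — install after both, DROP ALONE if either bounces; cert mc/pub-hodgecm-mc-period-1-g13/certs/cert-ArchSideOfTwistChar-e49c7781e83d.txt: compile over the symlink farm (PKG RUN-42 .lake + private #P43a olean + #CA22 cross-compiled from carch-1 pkg43 182e52b712e4 rc 0 / 39 s) rc 0 / 9 s / 0 warnings; axioms 5/5 trio certs/ax-ArchSideOfTwistChar-e49c7781e83d.log 936bd41c3ad9; NAME LIST (3 theorems): HodgeCM.Model.ArchSideTerm.archSideOfT_eq_archSideOfChar · HodgeCM.Model.ArchSideTerm.archSideOfT_P_eq_archSideOfChar_P · HodgeCM.Model.ArchSideTerm.archSideOfT_P_ω_eq_lineRepOf) (`HOME/mc/pub-hodgecm-mc-period-1-g13/stage43/HodgeCM/Model/ArchSideOfTwistChar.lean`,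 md5 e49c7781e83d, 81 lines);
landed by the gen-16 packager (p-g16) in gate run 43 as `HodgeCM/Model/ArchSideOfTwistChar.lean` (verbatim).
-/
/-
HodgeCM/Model/ArchSideOfTwistChar.lean — period-1 lane (gen 13): the ν-twisted S pin TERM `archSideOfT` of
`HodgeCM/Model/ArchSideOfTwist.lean` IS carch-1's character-generic term `archSideOfChar` of `HodgeCM/Model/ArchSideOfChar.lean` at the
twisted split `(etaT₀ V c.D η ν, etaT₁ V c.D η ν, eta₂ V c.D η, eta₃ V c.D η)` with period-1's two PROVED Weil hypotheses
(`hasThetaMajorants_lineRepT`, `lineRepT_mem_thetaStabilizerEnd`) — by `rfl` (the twin of carch-1's `archSideOf_eq_archSideOfChar` for the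
default split).  With `e := archSideOfT_eq_archSideOfChar …` every character-generic row-12 construction stated over `archSideOfChar`
(`ArchKTypeOfSlotChar` / `ArchKTypeOfSlotRecChar` / `ArchKTypeOfSideChar`: `… (e : S = archSideOfChar …) …`) serves a pin `S := archSideOfT …`
without a T-twin of those modules.  ADDITIVE bridge leaf: imports the two terms only; three `rfl` theorems; no records, no cited
facts, no E-binder, no placeholders.

Origin: Hodge-CM model-construction cell, row `S` of BINDER-OWNERS (period-1) × row 12 `C` (carch-1), repair (R1) of the LOCATED JUNCTION
«row 12 `C`, line k = 1» (STATUS 2026-08-20T06:09:56Z / 06:15:48Z / 06:47:37Z).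
-/
import Summits.HodgeConjecture.HodgeCM.Model.ArchSideOfTwist
import Summits.HodgeConjecture.HodgeCM.Model.ArchSideOfChar

/-! PORT of `HodgeCM/Model/ArchSideOfTwistChar.lean` (HodgeCMPerL run 82) — verbatim mechanical port; provenance in the PORT header line. -/

set_option autoImplicit false

noncomputable section

open scoped Matrix SchwartzMap
open NumberField NumberField.mixedEmbedding
open Literature.NumberTheory.Automorphic Literature.NumberTheory.Weil1964
open Literature.NumberTheory.GelbartRogawski1991.UnitaryDualPair
open HodgeCM.Adelic HodgeCM.PerL34
open Literature.Geometry.ComplexHyperbolic.BallModel (U21)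

namespace HodgeCM.Model

namespace ArchSideTerm

variable {L : CMField} {ι₁ : L →+* ℂ} (V : HermSpace3 L ι₁) (c : SeesawCtx L)
  (hGR : (cmSplittingDatum (L : Type) finProdFinEquiv (frameD V) (frameD_real V) (frameD_ne V) (dW c.D) (dW_real c.D)
    (dW_ne c.D)).CompatibleSplitting)
  (hGR₀ : (cmSplittingDatum (L : Type) (e₁) (frameD V) (frameD_real V) (frameD_ne V) (lineVec (L : Type) (dW c.D 0))
    (fun _ => dW_real c.D 0) (fun _ => dW_ne c.D 0)).CompatibleSplitting)
  (hGR₁ : (cmSplittingDatum (L : Type) (e₁) (frameD V) (frameD_real V) (frameD_ne V) (lineVec (L : Type) (dW c.D 1))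
    (fun _ => dW_real c.D 1) (fun _ => dW_ne c.D 1)).CompatibleSplitting)
  (hGR₂ : (cmSplittingDatum (L : Type) (e₁) (frameD V) (frameD_real V) (frameD_ne V) (lineVec (L : Type) (dW' c.D 0))
    (fun _ => dW'_real c.D 0) (fun _ => dW'_ne c.D 0)).CompatibleSplitting)
  (hGR₃ : (cmSplittingDatum (L : Type) (e₁) (frameD V) (frameD_real V) (frameD_ne V) (lineVec (L : Type) (dW' c.D 1))
    (fun _ => dW'_real c.D 1) (fun _ => dW'_ne c.D 1)).CompatibleSplitting)
  (η : CMAdelic (L : Type) (frameD V) × CMAdelic (L : Type) (dW c.D) →* ℂˣ)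
  (hη : ∀ γU ∈ CMRat (L : Type) (frameD V), ∀ γ ∈ CMRat (L : Type) (dW c.D), η (γU, γ) = 1)
  (hηc : Continuous fun p => ((η p : ℂˣ) : ℂ))
  (ν : CMAdelic (L : Type) (frameD V) →* ℂˣ)
  (hν : ∀ γU ∈ CMRat (L : Type) (frameD V), ν γU = 1)
  (hνc : Continuous fun v => ((ν v : ℂˣ) : ℂ))
  (h₁W : (∀ j, 0 < (ι₁ (dW c.D j)).re) ∨ ∀ j, (ι₁ (dW c.D j)).re < 0)
  (A : ∀ k : Fin 4, ArchLineInput V (lineRepT V c.D hGR hGR₀ hGR₁ hGR₂ hGR₃ η ν k))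

/-- **period-1's twisted term `archSideOfT` IS carch-1's `archSideOfChar` at the twisted split**
`(etaT₀ V c.D η ν, etaT₁ V c.D η ν, eta₂ V c.D η, eta₃ V c.D η)`, with its two PROVED Weil hypotheses
(`hasThetaMajorants_lineRepT`, `lineRepT_mem_thetaStabilizerEnd`) — `rfl`. -/
theorem archSideOfT_eq_archSideOfChar :
    archSideOfT V c hGR hGR₀ hGR₁ hGR₂ hGR₃ η hη hηc ν hν hνc h₁W A =
      archSideOfChar V c hGR hGR₀ hGR₁ hGR₂ hGR₃ (etaT₀ V c.D η ν) (etaT₁ V c.D η ν) (eta₂ V c.D η) (eta₃ V c.D η)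
        (hasThetaMajorants_lineRepT V c.D hGR hGR₀ hGR₁ hGR₂ hGR₃ η ν hηc hνc h₁W)
        (lineRepT_mem_thetaStabilizerEnd V c.D hGR hGR₀ hGR₁ hGR₂ hGR₃ η ν hη hν) A :=
  rfl

/-- the line data agree: `(archSideOfT …).P k = (archSideOfChar … (etaT₀ …) (etaT₁ …) (eta₂ …) (eta₃ …) … A).P k` (`rfl`). -/
theorem archSideOfT_P_eq_archSideOfChar_P (k : Fin 4) :
    (archSideOfT V c hGR hGR₀ hGR₁ hGR₂ hGR₃ η hη hηc ν hν hνc h₁W A).P k =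
      (archSideOfChar V c hGR hGR₀ hGR₁ hGR₂ hGR₃ (etaT₀ V c.D η ν) (etaT₁ V c.D η ν) (eta₂ V c.D η) (eta₃ V c.D η)
        (hasThetaMajorants_lineRepT V c.D hGR hGR₀ hGR₁ hGR₂ hGR₃ η ν hηc hνc h₁W)
        (lineRepT_mem_thetaStabilizerEnd V c.D hGR hGR₀ hGR₁ hGR₂ hGR₃ η ν hη hν) A).P k :=
  rfl

/-- the Weil representation of line `k`, displayed over LAYER B's `lineRepOf` at the twisted split (the currency of the
character-generic row-12 inputs `harchₖ`/`hfinₖ`): `((archSideOfT …).P k).ω = lineRepOf … (etaT₀ …) (etaT₁ …) (eta₂ …) (eta₃ …) k` (`rfl`). -/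
theorem archSideOfT_P_ω_eq_lineRepOf (k : Fin 4) :
    ((archSideOfT V c hGR hGR₀ hGR₁ hGR₂ hGR₃ η hη hηc ν hν hνc h₁W A).P k).ω =
      lineRepOf V c.D hGR hGR₀ hGR₁ hGR₂ hGR₃ (etaT₀ V c.D η ν) (etaT₁ V c.D η ν) (eta₂ V c.D η) (eta₃ V c.D η) k :=
  rfl

end ArchSideTerm

end HodgeCM.Model

end
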